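import Literature.MathematicalPhysics.QuantumLattice.TIGroundEnergyDensityResponse
import Literature.MathematicalPhysics.QuantumLattice.DWaveSourceNNNHopping
import Literature.MathematicalPhysics.QuantumLattice.HubbardNNNHoppingTorusLimitCorrelator
import Literature.MathematicalPhysics.QuantumLattice.InfVolFermionStateDensity
import Literature.MathematicalPhysics.QuantumLattice.InfVolFermionStateHubbardEnergy
import Literature.MathematicalPhysics.QuantumLattice.FinDimSpectrumProofs
import Literature.MathematicalPhysics.QuantumLattice.FockRelabel
import Literature.MathematicalPhysics.QuantumLattice.SectorEigenvalueContinuation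
import HarnessLib

/-!
# Torus limits of the pair-sourced `t–t'` Hubbard tori: the sourced mean energy is the limit of the
# energies per site, and certified torus energy rows bracket the induced pair amplitude of every
# thermodynamic-limit ground state

Topic `Literature/MathematicalPhysics/QuantumLattice`; namespace
`Literature.MathematicalPhysics.QuantumLattice` (the file path). Bridge between
`TIGroundEnergyDensityResponse.lean` (abstract translation-invariant states: the pencil-response brackets
`div_le_pairAmplitude_of_bounds` / `pairAmplitude_le_div_of_bounds` on the induced pair amplitude
`e_P(ω) = 2 Re ω(P₀)`) and the finite tori of `DWaveSourceNNNHopping.lean`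
(`A_L(h) = dWaveSourceTorusTT' L tp U μ h = H_L(1,tp,U) − μN − h(Δ_d + Δ_d†)`, Koma–Tasaki 1994 §1 source,
Xu et al. 2024 eq. (1) hoppings), whose certified ground-energy rows
`e·L² ≤ E₀(A_L(h))`, `E₀(A_L(h)) ≤ e'·L²` are the cells of the pinning-field menus.

* `torusAvgExpect_nAt` / `torusAvgExpect_localPairAt_zero`: the translation average of `n_{0σ}` is
  `⟨ψ, N_σ ψ⟩/L²` and that of the infinite-lattice local pair `P₀` is `⟨ψ, Δ_g ψ⟩/L²`, for EVERY torus
  vector (Bratteli–Robinson I §4.3.1 averaging).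
* `IsTorusLimitOf.tendsto_re_expect_dWaveSourceTorusTT'`: if `ω` is a torus limit of vectors `ψ_L` along
  `L_j → ∞`, then for EVERY source `h'` the energies per site `Re⟨ψ_{L_j}, A_{L_j}(h') ψ_{L_j}⟩/L_j²`
  converge to the sourced mean energy `e^{src}_{h'}(ω)` of
  `hubbardTTPrimeSourcedInteraction 1 tp U μ dWaveFormFactor h'` (the same vectors at all sources).
* Hence torus ENERGY ROWS feed the abstract brackets: a floor `lo·L² ≤ E₀(A_L(h'))` for all large `L`
  gives `lo ≤ e^{src}_{h'}(ω)` for every torus limit of UNIT vectors (variational principle on each torus,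
  `IsTorusLimitOf.le_meanEnergy_sourced_of_groundEnergy_ge`); if the `ψ_L` are ground-state vectors of
  `A_L(h)`, a ceiling `E₀(A_L(h)) ≤ hi·L²` gives `e^{src}_h(ω) ≤ hi`
  (`IsTorusLimitOf.meanEnergy_sourced_le_of_groundState_of_groundEnergy_le`); together
  (`IsTorusLimitOf.two_mul_re_expect_localPairAt_mem_Icc_of_groundEnergy_rows`): for every torus limit
  `ω` of unit ground-state vectors of `A_L(h)` and certified rows at `h − δ`, `h`, `h + δ`,
  `(lo₋ − hi)/δ ≤ 2 Re ω(P₀^d) ≤ (hi − lo₊)/δ` — Griffiths (1966) §II / Koma–Tasaki (1994) §1 read in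
  infinite volume from finite-torus certificates.

* Non-vacuity (`exists_isTorusLimitOf_dWaveSourceGroundStates`): unit ground-state vectors of `A_L(h)`
  and a torus-limit state of them exist along a subsequence of every `L_j → ∞` (weak-⋆ compactness); so
  three rows valid for all large `L` PRODUCE a translation-invariant state with bracketed pair amplitude
  (`exists_isTranslationInvariant_two_mul_re_expect_localPairAt_mem_Icc_of_groundEnergy_rows`).

* The chemical-potential pencil (source `0`): `IsTorusLimitOf.tendsto_re_expect_hubbardTorusTT'_sub_mul_totalNumber`
  (energies per site of `H_L − μ'N` → `e^{tt'}(ω) − μ'ρ(ω)`), floor / ceiling transport, and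
  `IsTorusLimitOf.density_mem_Icc_of_groundEnergy_rows`: three grand-canonical torus energy rows at
  `μ − δ, μ, μ + δ` bracket the DENSITY of every torus-limit ground state of `H_L − μN` (Ruelle 1969 §3.4).

Everything is PROVED; no definition, no named fact. HONEST SCOPE: a bound on the induced pair amplitude
at fixed `h > 0` is symmetry-allowed response, not `d`-wave order (`h → 0` after `L → ∞` is the tree's
`dWaveOrderParameterTT'`); the upper slot needs GROUND-STATE vectors at the SAME source `h`.

## References
* T. Koma, H. Tasaki, J. Stat. Phys. 76 (1994) 745–803, §1. [cite: KomaTasaki1994, §1]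
* R. B. Griffiths, Phys. Rev. 152 (1966) 240, §II. [cite: Griffiths1966, §II]
* O. Bratteli, D. W. Robinson, *Operator Algebras and Quantum Statistical Mechanics 1*, §4.3.1
  (invariant states as group averages; thermodynamic limits). [cite: BratteliRobinsonI1987, §4.3.1]
* H. Tasaki, *Physics and Mathematics of Quantum Many-Body Systems* (2020), §2.1 (variational principle).
  [cite: Tasaki2020, §2.1]
-/

noncomputable section

namespace Literature.MathematicalPhysics.QuantumLattice

open Matrix Finset HubbardWave0 _root_.Filter Literature.Probability.LatticeModels
open scoped _root_.Topology ComplexOrder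

/-! ### Torus averages of the density and of the local pair -/

section TorusAverages

variable (L : ℕ) [NeZero L]

/-- **The translation average of `n_{0σ}` is the spin-`σ` number per site**:
`avg_L(n_{0σ})(ψ) = ⟨ψ, Σ_y n_{yσ} ψ⟩ / L^d` for every torus vector `ψ` (the translates of `n_{0σ}`
exhaust the spin-`σ` number). [cite: BratteliRobinsonI1987, §4.3.1] -/
theorem torusAvgExpect_nAt {d : ℕ} (σ : Fin 2) (ψ : Fock (Orb (FermionTorus d L))) :
    torusAvgExpect L ({0} : Finset (Site d)) (nAt 0 (Finset.mem_singleton_self 0) σ) ψ =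
      expect (∑ y : FermionTorus d L, numberOp y σ) ψ / ((L : ℂ) ^ d) := by
  have h := injOn_proj_singleton (d := d) L 0
  have hcard : Fintype.card (TorusSite d L) = L ^ d := by simp [ZMod.card, Fintype.card_fin]
  have hproj : Torus.proj L (0 : Site d) = 0 := by funext i; simp [Torus.proj]
  rw [torusAvgExpect_eq, torusAvgExpectAt_of_injOn L h, hcard, Nat.cast_pow, div_eq_inv_mul]
  congr 1
  have hn : fermionEmbed (PolySite.toTorusEmb L h) (nAt 0 (Finset.mem_singleton_self 0) σ) =
      numberOp (FermionTorus.ofTorusSite (0 : TorusSite d L)) σ := by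
    rw [nAt, fermionEmbed_numberOp, PolySite.toTorusEmb_apply, PolySite.ofLex_coe_pt, hproj]
  rw [hn, sum_expect_numberOp_fockTranslate]

/-- `Σ_v ⟨ψ, f v ψ⟩ = ⟨ψ, (Σ_v f v) ψ⟩`. [folklore] -/
private theorem sum_expect_eq_expect_sum {ι κ : Type*} [Fintype κ] (s : Finset ι)
    (f : ι → Matrix (Finset κ) (Finset κ) ℂ) (ψ : Fock κ) :
    ∑ v ∈ s, expect (f v) ψ = expect (∑ v ∈ s, f v) ψ := by
  rw [expect, Matrix.sum_mulVec, dotProduct_sum]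
  rfl

/-- `⟨ψ, Aᴴ ψ⟩ = conj ⟨ψ, A ψ⟩`. [folklore] -/
private theorem star_dotProduct_conjTranspose_mulVec_eq_star {κ : Type*} [Fintype κ] (A : Matrix κ κ ℂ) (ψ : κ → ℂ) :
    star ψ ⬝ᵥ (Aᴴ *ᵥ ψ) = star (star ψ ⬝ᵥ (A *ᵥ ψ)) := by
  rw [star_dotProduct, star_mulVec, conjTranspose_conjTranspose, ← dotProduct_mulVec]

/-- `{0} ∪ ({0} + ({0} ∪ unitSteps)) ⊆ [-1,1]²`. [folklore] -/
private theorem pairRegion_insert_zero_unitSteps_subset_thicken :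
    pairRegion (insert (0 : Site 2) unitSteps) 0 ⊆ thicken ({0} : Finset (Site 2)) 1 := by
  intro z hz
  rw [pairRegion, Finset.mem_insert, Finset.mem_image] at hz
  rcases hz with rfl | ⟨e, he, rfl⟩
  · exact zero_mem_thicken_zero 1
  · rw [zero_add]
    rw [Finset.mem_insert] at he
    rcases he with rfl | he
    · exact zero_mem_thicken_zero 1
    · simp only [unitSteps, Finset.mem_insert, Finset.mem_singleton] at he
      rcases he with rfl | rfl | rfl | rfl
      · exact unitVec_mem_thicken_one 0
      · exact neg_unitVec_mem_thicken_one 0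
      · exact unitVec_mem_thicken_one 1
      · exact neg_unitVec_mem_thicken_one 1

/-- **The translation average of the local pair `P₀` is the pair field per site**:
`avg_L(P₀)(ψ) = ⟨ψ, Δ_g ψ⟩ / L²` for every vector `ψ` of a torus of side `L ≥ 3`
(`Γ(ι) P₀ = localPair g L 0` and its translates exhaust `Δ_g = Σ_x localPair g L x`).
[cite: BratteliRobinsonI1987, §4.3.1] -/
theorem torusAvgExpect_localPairAt_zero (g : Site 2 → ℝ) (hL : 3 ≤ L)
    (ψ : Fock (Orb (FermionTorus 2 L))) :
    torusAvgExpect L (pairRegion (insert (0 : Site 2) unitSteps) 0) (localPairAt (insert 0 unitSteps) g 0) ψ =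
      expect (pairField g L) ψ / ((L : ℂ) ^ 2) := by
  have hR : Set.InjOn (Torus.proj (d := 2) L) ↑(pairRegion (insert (0 : Site 2) unitSteps) 0) :=
    (injOn_proj_thicken_one (d := 2) hL).mono (Finset.coe_subset.2 pairRegion_insert_zero_unitSteps_subset_thicken)
  have hcard : Fintype.card (TorusSite 2 L) = L ^ 2 := by simp [ZMod.card, Fintype.card_fin]
  have hproj : Torus.proj L (0 : Site 2) = 0 := by funext i; simp [Torus.proj]
  rw [torusAvgExpect_eq, torusAvgExpectAt_of_injOn L hR, hcard, Nat.cast_pow, div_eq_inv_mul]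
  congr 1
  rw [fermionEmbed_toTorusEmb_localPairAt L _ g 0 hR, hproj, localPairOn_insert_zero_unitSteps]
  have hstep : ∀ v : TorusSite 2 L,
      expect (localPair g L 0) ((fockTranslate v).val *ᵥ ψ) = expect (localPair g L (0 + -v)) ψ := by
    intro v
    rw [expect_fockRelabel_mulVec, ← Equiv.Perm.inv_def, ← Orb.translate_neg, relabel_translate_localPair]
  simp_rw [hstep]
  rw [Fintype.sum_equiv (Equiv.neg (TorusSite 2 L)) (fun v => expect (localPair g L (0 + -v)) ψ)
      (fun v => expect (localPair g L v) ψ) (fun v => by simp), sum_expect_eq_expect_sum]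
  rfl

end TorusAverages

/-! ### The sourced mean energy of a torus limit is the limit of the energies per site -/

section Limits

variable {ω : InfVolFermionState 2} {ψ : ∀ L, Fock (Orb (FermionTorus 2 L))} {Ls : ℕ → ℕ}

/-- **The energies per site of the pair-sourced tori converge to the sourced mean energy of the torus
limit**, simultaneously for all sources: if `ω` is a torus limit of the vectors `ψ_L` along `L_j → ∞`,
then for every `tp, U, μ, h'`,
`Re⟨ψ_{L_j}, A_{L_j}(h') ψ_{L_j}⟩ / L_j² → e^{src}_{h'}(ω) = e^{1,tp,U}(ω) − μρ(ω) − h'·2 Re ω(P₀^d)`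
(`A_L = dWaveSourceTorusTT'`; the three pieces converge by the defining property of a torus limit applied to
`E^{tt'}_Φ`, `n_{0↑} + n_{0↓}` and `P₀`). [cite: BratteliRobinsonI1987, §4.3.1] -/
theorem InfVolFermionState.IsTorusLimitOf.tendsto_re_expect_dWaveSourceTorusTT' [hL0 : ∀ j, NeZero (Ls j)]
    (hω : ω.IsTorusLimitOf ψ Ls) (hLs : Tendsto Ls atTop atTop) (tp U μ h' : ℝ) :
    Tendsto (fun j => (QuantumLattice.expect (dWaveSourceTorusTT' (Ls j) tp U μ h') (ψ (Ls j))).re / (Ls j : ℝ) ^ 2)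
      atTop (𝓝 (ω.meanEnergy (hubbardTTPrimeSourcedInteraction 1 tp U μ dWaveFormFactor h') 1)) := by
  -- the three limits
  have hE := hω (thicken ({0} : Finset (Site 2)) 1) ((hubbardTTPrimeFermionInteraction 1 tp U).meanEnergyObs 1)
  have hN0 := hω ({0} : Finset (Site 2)) (nAt 0 (Finset.mem_singleton_self 0) 0)
  have hN1 := hω ({0} : Finset (Site 2)) (nAt 0 (Finset.mem_singleton_self 0) 1)
  have hP := hω (pairRegion (insert (0 : Site 2) unitSteps) 0) (localPairAt (insert 0 unitSteps) dWaveFormFactor 0)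
  -- the target, rewritten
  have htarget : ω.meanEnergy (hubbardTTPrimeSourcedInteraction 1 tp U μ dWaveFormFactor h') 1 =
      (ω.expect _ ((hubbardTTPrimeFermionInteraction 1 tp U).meanEnergyObs 1)).re -
        μ * ((ω.expect {0} (nAt 0 (Finset.mem_singleton_self 0) 0)).re +
          (ω.expect {0} (nAt 0 (Finset.mem_singleton_self 0) 1)).re) -
        h' * (2 * (ω.expect (pairRegion (insert (0 : Site 2) unitSteps) 0)
          (localPairAt (insert 0 unitSteps) dWaveFormFactor 0)).re) := by
    rw [InfVolFermionState.meanEnergy_hubbardTTPrimeSourced, ← InfVolFermionState.meanEnergy_pairSourceInteraction_dWave_eq,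
      InfVolFermionState.meanEnergy, InfVolFermionState.density, InfVolFermionState.densityAt, map_add, Complex.add_re]
  rw [htarget]
  -- the sequence, rewritten eventually
  have hseq : ∀ᶠ j in atTop,
      (QuantumLattice.expect (dWaveSourceTorusTT' (Ls j) tp U μ h') (ψ (Ls j))).re / (Ls j : ℝ) ^ 2 =
        (torusAvgExpect (Ls j) (thicken ({0} : Finset (Site 2)) 1)
            ((hubbardTTPrimeFermionInteraction 1 tp U).meanEnergyObs 1) (ψ (Ls j))).re -
          μ * ((torusAvgExpect (Ls j) ({0} : Finset (Site 2)) (nAt 0 (Finset.mem_singleton_self 0) 0) (ψ (Ls j))).re +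
            (torusAvgExpect (Ls j) ({0} : Finset (Site 2)) (nAt 0 (Finset.mem_singleton_self 0) 1) (ψ (Ls j))).re) -
          h' * (2 * (torusAvgExpect (Ls j) (pairRegion (insert (0 : Site 2) unitSteps) 0)
            (localPairAt (insert 0 unitSteps) dWaveFormFactor 0) (ψ (Ls j))).re) := by
    filter_upwards [hLs.eventually_ge_atTop 3] with j hj
    rw [torusAvgExpect_hubbardTTPrime_meanEnergyObs 1 tp U hj, torusAvgExpect_nAt, torusAvgExpect_nAt,
      torusAvgExpect_localPairAt_zero (Ls j) dWaveFormFactor hj]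
    -- `A_L = H − μN − h'(Δ + Δᴴ)` inside `expect`, and `N = Σ_σ Σ_y n_{yσ}`
    have hN : (totalNumber : Matrix (Finset (Orb (FermionTorus 2 (Ls j)))) (Finset (Orb (FermionTorus 2 (Ls j)))) ℂ) =
        (∑ y : FermionTorus 2 (Ls j), numberOp y 0) + ∑ y : FermionTorus 2 (Ls j), numberOp y 1 := by
      rw [totalNumber, ← Finset.sum_add_distrib]
      exact Finset.sum_congr rfl fun y _ => Fin.sum_univ_two _
    have hexp : QuantumLattice.expect (dWaveSourceTorusTT' (Ls j) tp U μ h') (ψ (Ls j)) =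
        QuantumLattice.expect (hubbardTorusTT' (Ls j) 1 tp U) (ψ (Ls j)) -
          (μ : ℂ) * (QuantumLattice.expect (∑ y : FermionTorus 2 (Ls j), numberOp y 0) (ψ (Ls j)) +
            QuantumLattice.expect (∑ y : FermionTorus 2 (Ls j), numberOp y 1) (ψ (Ls j))) -
          (h' : ℂ) * (QuantumLattice.expect (pairField dWaveFormFactor (Ls j)) (ψ (Ls j)) +
            star (QuantumLattice.expect (pairField dWaveFormFactor (Ls j)) (ψ (Ls j)))) := by
      unfold dWaveSourceTorusTT'
      rw [hN]
      simp only [QuantumLattice.expect, Matrix.sub_mulVec, Matrix.add_mulVec, Matrix.smul_mulVec, dotProduct_sub,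
        dotProduct_add, dotProduct_smul, smul_eq_mul]
      rw [star_dotProduct_conjTranspose_mulVec_eq_star]
    rw [hexp]
    have hL0 : ((Ls j : ℝ)) ^ 2 ≠ 0 := by positivity
    have hLc : ((Ls j : ℂ)) ^ 2 = (((Ls j : ℝ) ^ 2 : ℝ) : ℂ) := by push_cast; ring
    simp only [hLc, Complex.div_ofReal_re, Complex.sub_re, Complex.add_re, Complex.mul_re, Complex.ofReal_re,
      Complex.ofReal_im, zero_mul, sub_zero, Complex.star_def, Complex.conj_re]
    field_simp
    ring
  refine Tendsto.congr' (EventuallyEq.symm hseq) ?_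
  have hre : ∀ {f : ℕ → ℂ} {a : ℂ}, Tendsto f atTop (𝓝 a) → Tendsto (fun j => (f j).re) atTop (𝓝 a.re) :=
    fun hf => (Complex.continuous_re.tendsto _).comp hf
  exact ((hre hE).sub (((hre hN0).add (hre hN1)).const_mul μ)).sub (((hre hP).const_mul 2).const_mul h')

/-- **A torus energy FLOOR bounds the sourced mean energy of every torus limit of unit vectors from
below**: if `lo·L_j² ≤ E₀(A_{L_j}(h'))` for all large `j` and the `ψ_{L_j}` are unit vectors, then
`lo ≤ e^{src}_{h'}(ω)` (variational principle `E₀ ≤ ⟨ψ, A ψ⟩` on each torus, then the limit).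
[cite: Tasaki2020, §2.1] -/
theorem InfVolFermionState.IsTorusLimitOf.le_meanEnergy_sourced_of_groundEnergy_ge [hL0 : ∀ j, NeZero (Ls j)] (hω : ω.IsTorusLimitOf ψ Ls)
    (hLs : Tendsto Ls atTop atTop) (hψ : ∀ j, star (ψ (Ls j)) ⬝ᵥ ψ (Ls j) = 1) (tp U μ h' : ℝ) {lo : ℝ}
    (hlo : ∀ᶠ j in atTop, lo * (Ls j : ℝ) ^ 2 ≤
      Matrix.groundEnergy (dWaveSourceTorusTT' (Ls j) tp U μ h')) :
    lo ≤ ω.meanEnergy (hubbardTTPrimeSourcedInteraction 1 tp U μ dWaveFormFactor h') 1 := by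
  refine ge_of_tendsto (hω.tendsto_re_expect_dWaveSourceTorusTT' hLs tp U μ h') ?_
  filter_upwards [hlo, hLs.eventually_ge_atTop 1] with j hj hj1
  have hL : (0 : ℝ) < (Ls j : ℝ) ^ 2 := by positivity
  rw [le_div_iff₀ hL]
  exact hj.trans (Matrix.groundEnergy_le_rayleigh_holds (dWaveSourceTorusTT'_isHermitian (Ls j) tp U μ h')
    (ψ (Ls j)) (hψ j))

/-- **A torus energy CEILING at the source of the ground states bounds the sourced mean energy from
above**: if the `ψ_{L_j}` are unit GROUND-STATE vectors of `A_{L_j}(h)` (`A ψ = E₀ ψ`) and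
`E₀(A_{L_j}(h)) ≤ hi·L_j²` for all large `j`, then `e^{src}_h(ω) ≤ hi`. [cite: Tasaki2020, §2.1] -/
theorem InfVolFermionState.IsTorusLimitOf.meanEnergy_sourced_le_of_groundState_of_groundEnergy_le [hL0 : ∀ j, NeZero (Ls j)]
    (hω : ω.IsTorusLimitOf ψ Ls)
    (hLs : Tendsto Ls atTop atTop) (hψ : ∀ j, star (ψ (Ls j)) ⬝ᵥ ψ (Ls j) = 1) (tp U μ h : ℝ)
    (hgs : ∀ j, dWaveSourceTorusTT' (Ls j) tp U μ h *ᵥ ψ (Ls j) =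
      ((Matrix.groundEnergy (dWaveSourceTorusTT' (Ls j) tp U μ h) : ℝ) : ℂ) • ψ (Ls j))
    {hi : ℝ} (hhi : ∀ᶠ j in atTop, Matrix.groundEnergy (dWaveSourceTorusTT' (Ls j) tp U μ h) ≤ hi * (Ls j : ℝ) ^ 2) :
    ω.meanEnergy (hubbardTTPrimeSourcedInteraction 1 tp U μ dWaveFormFactor h) 1 ≤ hi := by
  refine le_of_tendsto (hω.tendsto_re_expect_dWaveSourceTorusTT' hLs tp U μ h) ?_
  filter_upwards [hhi, hLs.eventually_ge_atTop 1] with j hj hj1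
  have hL : (0 : ℝ) < (Ls j : ℝ) ^ 2 := by positivity
  rw [div_le_iff₀ hL]
  have hval : (QuantumLattice.expect (dWaveSourceTorusTT' (Ls j) tp U μ h) (ψ (Ls j))).re =
      Matrix.groundEnergy (dWaveSourceTorusTT' (Ls j) tp U μ h) := by
    rw [QuantumLattice.expect, hgs j, dotProduct_smul, hψ j, smul_eq_mul, mul_one, Complex.ofReal_re]
  rw [hval]
  exact hj

/-- **The induced `d`-wave pair amplitude of a thermodynamic-limit ground state, bracketed by three
certified torus energy rows.** Let `ω` be a torus limit of unit ground-state vectors `ψ_L` of the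
pair-sourced tori `A_L(h) = dWaveSourceTorusTT' L tp U μ h` along `L_j → ∞`; let `δ > 0` and suppose the
certified rows `lo₋·L² ≤ E₀(A_L(h − δ))`, `lo₊·L² ≤ E₀(A_L(h + δ))`, `E₀(A_L(h)) ≤ hi·L²` hold for all large
`L = L_j`. Then the induced pair amplitude `e_P(ω) = 2 Re ω(P₀^d)` (`P₀^d = localPairAt ({0} ∪ unitSteps)
dWaveFormFactor 0`) satisfies `(lo₋ − hi)/δ ≤ 2 Re ω(P₀^d) ≤ (hi − lo₊)/δ` — Griffiths' / Koma–Tasaki's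
finite-difference Hellmann–Feynman brackets read in infinite volume. [cite: Griffiths1966, §II] -/
theorem InfVolFermionState.IsTorusLimitOf.two_mul_re_expect_localPairAt_mem_Icc_of_groundEnergy_rows [hL0 : ∀ j, NeZero (Ls j)]
    (hω : ω.IsTorusLimitOf ψ Ls)
    (hLs : Tendsto Ls atTop atTop) (hψ : ∀ j, star (ψ (Ls j)) ⬝ᵥ ψ (Ls j) = 1) (tp U μ h : ℝ)
    (hgs : ∀ j, dWaveSourceTorusTT' (Ls j) tp U μ h *ᵥ ψ (Ls j) =
      ((Matrix.groundEnergy (dWaveSourceTorusTT' (Ls j) tp U μ h) : ℝ) : ℂ) • ψ (Ls j))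
    {δ loMinus loPlus hi : ℝ} (hδ : 0 < δ)
    (hloMinus : ∀ᶠ j in atTop, loMinus * (Ls j : ℝ) ^ 2 ≤
      Matrix.groundEnergy (dWaveSourceTorusTT' (Ls j) tp U μ (h - δ)))
    (hloPlus : ∀ᶠ j in atTop, loPlus * (Ls j : ℝ) ^ 2 ≤
      Matrix.groundEnergy (dWaveSourceTorusTT' (Ls j) tp U μ (h + δ)))
    (hhi : ∀ᶠ j in atTop, Matrix.groundEnergy (dWaveSourceTorusTT' (Ls j) tp U μ h) ≤ hi * (Ls j : ℝ) ^ 2) :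
    2 * (ω.expect (pairRegion (insert (0 : Site 2) unitSteps) 0)
        (localPairAt (insert 0 unitSteps) dWaveFormFactor 0)).re ∈
      Set.Icc ((loMinus - hi) / δ) ((hi - loPlus) / δ) := by
  rw [← InfVolFermionState.meanEnergy_pairSourceInteraction_dWave_eq]
  have hhi' := hω.meanEnergy_sourced_le_of_groundState_of_groundEnergy_le hLs hψ tp U μ h hgs hhi
  exact ⟨ω.div_le_pairAmplitude_of_bounds hδ
      (hω.le_meanEnergy_sourced_of_groundEnergy_ge hLs hψ tp U μ (h - δ) hloMinus) hhi',
    ω.pairAmplitude_le_div_of_bounds hδ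
      (hω.le_meanEnergy_sourced_of_groundEnergy_ge hLs hψ tp U μ (h + δ) hloPlus) hhi'⟩

/-- **Such a torus limit is translation invariant and its sourced mean energy is the limit of the
ground energies per site** — so, by `tiGroundEnergyDensity_le_meanEnergy`, the TI ground-state energy
density of the sourced interaction is at most that limit: for unit ground-state vectors with
`E₀(A_{L_j}(h))/L_j² → e`, `tiGroundEnergyDensity (sourced h) 1 ≤ e`. [cite: BratteliKishimotoRobinson1978, Thm. 2 (condition 2)] -/
theorem InfVolFermionState.IsTorusLimitOf.tiGroundEnergyDensity_sourced_le_of_tendsto [hL0 : ∀ j, NeZero (Ls j)]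
    (hω : ω.IsTorusLimitOf ψ Ls)
    (hLs : Tendsto Ls atTop atTop) (hψ : ∀ j, star (ψ (Ls j)) ⬝ᵥ ψ (Ls j) = 1) (tp U μ h : ℝ)
    (hgs : ∀ j, dWaveSourceTorusTT' (Ls j) tp U μ h *ᵥ ψ (Ls j) =
      ((Matrix.groundEnergy (dWaveSourceTorusTT' (Ls j) tp U μ h) : ℝ) : ℂ) • ψ (Ls j))
    {e : ℝ} (he : Tendsto (fun j => Matrix.groundEnergy (dWaveSourceTorusTT' (Ls j) tp U μ h) / (Ls j : ℝ) ^ 2)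
      atTop (𝓝 e)) :
    (hubbardTTPrimeSourcedInteraction 1 tp U μ dWaveFormFactor h).tiGroundEnergyDensity 1 ≤ e := by
  have hlim := hω.tendsto_re_expect_dWaveSourceTorusTT' hLs tp U μ h
  have heq : ∀ᶠ j in atTop, Matrix.groundEnergy (dWaveSourceTorusTT' (Ls j) tp U μ h) / (Ls j : ℝ) ^ 2 =
      (QuantumLattice.expect (dWaveSourceTorusTT' (Ls j) tp U μ h) (ψ (Ls j))).re / (Ls j : ℝ) ^ 2 := by
    filter_upwards with j
    rw [QuantumLattice.expect, hgs j, dotProduct_smul, hψ j, smul_eq_mul, mul_one, Complex.ofReal_re]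
  have hmean : ω.meanEnergy (hubbardTTPrimeSourcedInteraction 1 tp U μ dWaveFormFactor h) 1 = e :=
    tendsto_nhds_unique hlim (he.congr' heq)
  rw [← hmean]
  exact (hubbardTTPrimeSourcedInteraction 1 tp U μ dWaveFormFactor h).tiGroundEnergyDensity_le_meanEnergy 1
    hω.isTranslationInvariant

end Limits

/-! ### Non-vacuity: torus-limit ground states of the pair-sourced tori exist -/

section Existence

/-- A unit ground-state vector of the pair-sourced torus (a Hermitian matrix on a nonempty finite index
type has a ground state, normalised). [cite: Tasaki2020, §2.1] -/
theorem exists_unit_groundStateVector_dWaveSourceTorusTT' (L : ℕ) [NeZero L] (tp U μ h : ℝ) :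
    ∃ v : Fock (Orb (FermionTorus 2 L)),
      dWaveSourceTorusTT' L tp U μ h *ᵥ v =
          ((Matrix.groundEnergy (dWaveSourceTorusTT' L tp U μ h) : ℝ) : ℂ) • v ∧
        star v ⬝ᵥ v = 1 := by
  have hA := dWaveSourceTorusTT'_isHermitian L tp U μ h
  obtain ⟨w, hw, hw0⟩ := (Submodule.ne_bot_iff _).1 (Matrix.groundSpace_ne_bot_holds hA)
  have hAw := (Matrix.mem_groundSpace_iff _ w).1 hw
  obtain ⟨c, -, -, hc1⟩ := EigenvalueContinuation.exists_normalize hw0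
  refine ⟨(c : ℂ) • w, ?_, hc1⟩
  rw [Matrix.mulVec_smul, hAw, smul_comm]

/-- **Torus-limit ground states of the pair-sourced `t–t'` tori exist along a subsequence of every
`Ls → ∞`** (so the brackets above are about a nonempty class): there are unit ground-state vectors
`ψ_L` of `A_L(h) = dWaveSourceTorusTT' L tp U μ h` (every `L ≥ 1`), a subsequence `Ls ∘ φ` and an
infinite-volume state `ω` on `ℤ²` which is their torus limit (weak-⋆ compactness,
`InfVolFermionState.exists_isTorusLimitOf_subseq`); `ω` is translation invariant.
[cite: BratteliRobinsonI1987, §4.3.1] -/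
theorem exists_isTorusLimitOf_dWaveSourceGroundStates (tp U μ h : ℝ) {Ls : ℕ → ℕ}
    [hL0 : ∀ j, NeZero (Ls j)] (hLs : Tendsto Ls atTop atTop) :
    ∃ (ψ : ∀ L, Fock (Orb (FermionTorus 2 L))) (φ : ℕ → ℕ) (ω : InfVolFermionState 2),
      StrictMono φ ∧
      (∀ j, dWaveSourceTorusTT' (Ls j) tp U μ h *ᵥ ψ (Ls j) =
          ((Matrix.groundEnergy (dWaveSourceTorusTT' (Ls j) tp U μ h) : ℝ) : ℂ) • ψ (Ls j)) ∧
      (∀ j, star (ψ (Ls j)) ⬝ᵥ ψ (Ls j) = 1) ∧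
      ω.IsTorusLimitOf ψ (Ls ∘ φ) ∧ ω.IsTranslationInvariant := by
  classical
  -- a unit ground-state vector on every torus of side `L ≠ 0` (junk `0` at `L = 0`)
  have hex : ∀ L : ℕ, ∃ v : Fock (Orb (FermionTorus 2 L)), ∀ hL : L ≠ 0,
      @dWaveSourceTorusTT' L ⟨hL⟩ tp U μ h *ᵥ v =
          ((Matrix.groundEnergy (@dWaveSourceTorusTT' L ⟨hL⟩ tp U μ h) : ℝ) : ℂ) • v ∧
        star v ⬝ᵥ v = 1 := by
    intro L
    by_cases hL : L = 0
    · exact ⟨0, fun h' => absurd hL h'⟩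
    · obtain ⟨v, hv, hv1⟩ := @exists_unit_groundStateVector_dWaveSourceTorusTT' L ⟨hL⟩ tp U μ h
      exact ⟨v, fun _ => ⟨hv, hv1⟩⟩
  choose ψ hψ using hex
  have hgs : ∀ j, dWaveSourceTorusTT' (Ls j) tp U μ h *ᵥ ψ (Ls j) =
      ((Matrix.groundEnergy (dWaveSourceTorusTT' (Ls j) tp U μ h) : ℝ) : ℂ) • ψ (Ls j) :=
    fun j => (hψ (Ls j) (hL0 j).ne).1
  have hψ1 : ∀ j, star (ψ (Ls j)) ⬝ᵥ ψ (Ls j) = 1 := fun j => (hψ (Ls j) (hL0 j).ne).2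
  obtain ⟨φ, hφ, ω, hω⟩ := InfVolFermionState.exists_isTorusLimitOf_subseq ψ hLs hψ1
  exact ⟨ψ, φ, ω, hφ, hgs, hψ1, hω, hω.isTranslationInvariant⟩

/-- **Hence three certified torus energy rows produce a translation-invariant infinite-volume state with
bracketed induced pair amplitude**: under rows `lo₋·L² ≤ E₀(A_L(h−δ))`, `lo₊·L² ≤ E₀(A_L(h+δ))`,
`E₀(A_L(h)) ≤ hi·L²` valid for all large `L`, there is a translation-invariant state `ω` on `ℤ²` — a
torus limit of unit ground states of `A_L(h)` — with `(lo₋ − hi)/δ ≤ 2 Re ω(P₀^d) ≤ (hi − lo₊)/δ`.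
[cite: Griffiths1966, §II] -/
theorem exists_isTranslationInvariant_two_mul_re_expect_localPairAt_mem_Icc_of_groundEnergy_rows
    (tp U μ h : ℝ) {δ loMinus loPlus hi : ℝ} (hδ : 0 < δ)
    (hloMinus : ∀ᶠ L : ℕ in atTop, ∀ [NeZero L], loMinus * (L : ℝ) ^ 2 ≤
      Matrix.groundEnergy (dWaveSourceTorusTT' L tp U μ (h - δ)))
    (hloPlus : ∀ᶠ L : ℕ in atTop, ∀ [NeZero L], loPlus * (L : ℝ) ^ 2 ≤
      Matrix.groundEnergy (dWaveSourceTorusTT' L tp U μ (h + δ)))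
    (hhi : ∀ᶠ L : ℕ in atTop, ∀ [NeZero L],
      Matrix.groundEnergy (dWaveSourceTorusTT' L tp U μ h) ≤ hi * (L : ℝ) ^ 2) :
    ∃ ω : InfVolFermionState 2, ω.IsTranslationInvariant ∧
      (∃ (ψ : ∀ L, Fock (Orb (FermionTorus 2 L))) (Ls : ℕ → ℕ), Tendsto Ls atTop atTop ∧
        (∀ j, star (ψ (Ls j)) ⬝ᵥ ψ (Ls j) = 1) ∧
        (∀ j, ∀ [NeZero (Ls j)], dWaveSourceTorusTT' (Ls j) tp U μ h *ᵥ ψ (Ls j) =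
          ((Matrix.groundEnergy (dWaveSourceTorusTT' (Ls j) tp U μ h) : ℝ) : ℂ) • ψ (Ls j)) ∧
        ω.IsTorusLimitOf ψ Ls) ∧
      2 * (ω.expect (pairRegion (insert (0 : Site 2) unitSteps) 0)
          (localPairAt (insert 0 unitSteps) dWaveFormFactor 0)).re ∈
        Set.Icc ((loMinus - hi) / δ) ((hi - loPlus) / δ) := by
  -- sides `L = j + 1`
  haveI hL0 : ∀ j : ℕ, NeZero (j + 1) := fun j => ⟨Nat.succ_ne_zero j⟩
  have hLs : Tendsto (fun j : ℕ => j + 1) atTop atTop := tendsto_add_atTop_nat 1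
  obtain ⟨ψ, φ, ω, hφ, hgs, hψ1, hω, hTI⟩ :=
    exists_isTorusLimitOf_dWaveSourceGroundStates tp U μ h (Ls := fun j : ℕ => j + 1) hLs
  have hLφ : Tendsto (fun j => φ j + 1) atTop atTop := hLs.comp hφ.tendsto_atTop
  haveI hL0' : ∀ j : ℕ, NeZero (φ j + 1) := fun j => hL0 (φ j)
  have hω' : ω.IsTorusLimitOf ψ (fun j => φ j + 1) := hω
  refine ⟨ω, hTI, ⟨ψ, fun j => φ j + 1, hLφ, fun j => hψ1 (φ j), fun j _ => hgs (φ j), hω'⟩, ?_⟩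
  exact hω'.two_mul_re_expect_localPairAt_mem_Icc_of_groundEnergy_rows hLφ (fun j => hψ1 (φ j)) tp U μ h
    (fun j => hgs (φ j)) hδ
    ((hLφ.eventually hloMinus).mono fun j hj => hj)
    ((hLφ.eventually hloPlus).mono fun j hj => hj)
    ((hLφ.eventually hhi).mono fun j hj => hj)

/-- The same along a prescribed side sequence `Ls → ∞` (e.g. `L_j = q·(j+1)` when the certified rows
hold only for `q ∣ L`): rows valid eventually ALONG `Ls` produce a translation-invariant torus-limit
ground state (along a subsequence of `Ls`) with bracketed induced pair amplitude. [cite: Griffiths1966, §II] -/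
theorem exists_isTranslationInvariant_two_mul_re_expect_localPairAt_mem_Icc_of_groundEnergy_rows_along
    (tp U μ h : ℝ) {Ls : ℕ → ℕ} [hL0 : ∀ j, NeZero (Ls j)] (hLs : Tendsto Ls atTop atTop)
    {δ loMinus loPlus hi : ℝ} (hδ : 0 < δ)
    (hloMinus : ∀ᶠ j in atTop, loMinus * (Ls j : ℝ) ^ 2 ≤
      Matrix.groundEnergy (dWaveSourceTorusTT' (Ls j) tp U μ (h - δ)))
    (hloPlus : ∀ᶠ j in atTop, loPlus * (Ls j : ℝ) ^ 2 ≤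
      Matrix.groundEnergy (dWaveSourceTorusTT' (Ls j) tp U μ (h + δ)))
    (hhi : ∀ᶠ j in atTop, Matrix.groundEnergy (dWaveSourceTorusTT' (Ls j) tp U μ h) ≤ hi * (Ls j : ℝ) ^ 2) :
    ∃ ω : InfVolFermionState 2, ω.IsTranslationInvariant ∧
      (∃ (ψ : ∀ L, Fock (Orb (FermionTorus 2 L))) (φ : ℕ → ℕ), StrictMono φ ∧
        (∀ j, star (ψ (Ls j)) ⬝ᵥ ψ (Ls j) = 1) ∧
        (∀ j, dWaveSourceTorusTT' (Ls j) tp U μ h *ᵥ ψ (Ls j) =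
          ((Matrix.groundEnergy (dWaveSourceTorusTT' (Ls j) tp U μ h) : ℝ) : ℂ) • ψ (Ls j)) ∧
        ω.IsTorusLimitOf ψ (Ls ∘ φ)) ∧
      2 * (ω.expect (pairRegion (insert (0 : Site 2) unitSteps) 0)
          (localPairAt (insert 0 unitSteps) dWaveFormFactor 0)).re ∈
        Set.Icc ((loMinus - hi) / δ) ((hi - loPlus) / δ) := by
  obtain ⟨ψ, φ, ω, hφ, hgs, hψ1, hω, hTI⟩ := exists_isTorusLimitOf_dWaveSourceGroundStates tp U μ h hLs
  have hLφ : Tendsto (fun j => Ls (φ j)) atTop atTop := hLs.comp hφ.tendsto_atTop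
  haveI hL0' : ∀ j : ℕ, NeZero (Ls (φ j)) := fun j => hL0 (φ j)
  have hω' : ω.IsTorusLimitOf ψ (fun j => Ls (φ j)) := hω
  refine ⟨ω, hTI, ⟨ψ, φ, hφ, hψ1, hgs, hω⟩, ?_⟩
  exact hω'.two_mul_re_expect_localPairAt_mem_Icc_of_groundEnergy_rows hLφ (fun j => hψ1 (φ j)) tp U μ h
    (fun j => hgs (φ j)) hδ (hφ.tendsto_atTop.eventually hloMinus) (hφ.tendsto_atTop.eventually hloPlus)
    (hφ.tendsto_atTop.eventually hhi)

end Existence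

/-! ### The chemical-potential pencil: density brackets for torus-limit grand-canonical ground states

The source-free case read along the `μ`-pencil `G_L(μ') = H_L(1,tp,U) − μ' N`
(`= dWaveSourceTorusTT' L tp U μ' 0`, `dWaveSourceTorusTT'_zero_source`): the energies per site converge
to `e^{tt'}(ω) − μ' ρ(ω) = ω.meanEnergy (hubbardTTPrimeMuInteraction 1 tp U μ') 1`, and three
grand-canonical torus energy rows at `μ − δ`, `μ`, `μ + δ` bracket the DENSITY of every torus-limit ground
state of `G_L(μ)` (Ruelle 1969 §3.4: `ρ ∈ −∂e_GC(μ)`; Griffiths' lemma). No `NeZero` bookkeeping is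
needed in the statements (`hubbardTorusTT'` and `totalNumber` make sense on the empty torus). -/

section ChemicalPotential

variable {ω : InfVolFermionState 2} {ψ : ∀ L, Fock (Orb (FermionTorus 2 L))} {Ls : ℕ → ℕ}

/-- **The grand-canonical energies per site converge to `e^{tt'}(ω) − μ'ρ(ω)`** along every torus limit,
for every `μ'`. [cite: BratteliRobinsonI1987, §4.3.1] -/
theorem InfVolFermionState.IsTorusLimitOf.tendsto_re_expect_hubbardTorusTT'_sub_mul_totalNumber
    (hω : ω.IsTorusLimitOf ψ Ls) (hLs : Tendsto Ls atTop atTop) (tp U μ' : ℝ) :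
    Tendsto (fun j => (QuantumLattice.expect (hubbardTorusTT' (Ls j) 1 tp U - (μ' : ℂ) • totalNumber)
        (ψ (Ls j))).re / (Ls j : ℝ) ^ 2)
      atTop (𝓝 (ω.meanEnergy (hubbardTTPrimeMuInteraction 1 tp U μ') 1)) := by
  have hE := hω (thicken ({0} : Finset (Site 2)) 1) ((hubbardTTPrimeFermionInteraction 1 tp U).meanEnergyObs 1)
  have hN0 := hω ({0} : Finset (Site 2)) (nAt 0 (Finset.mem_singleton_self 0) 0)
  have hN1 := hω ({0} : Finset (Site 2)) (nAt 0 (Finset.mem_singleton_self 0) 1)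
  have htarget : ω.meanEnergy (hubbardTTPrimeMuInteraction 1 tp U μ') 1 =
      (ω.expect _ ((hubbardTTPrimeFermionInteraction 1 tp U).meanEnergyObs 1)).re -
        μ' * ((ω.expect {0} (nAt 0 (Finset.mem_singleton_self 0) 0)).re +
          (ω.expect {0} (nAt 0 (Finset.mem_singleton_self 0) 1)).re) := by
    rw [InfVolFermionState.meanEnergy_hubbardTTPrimeMu, InfVolFermionState.meanEnergy,
      InfVolFermionState.density, InfVolFermionState.densityAt, map_add, Complex.add_re]
  rw [htarget]
  have hseq : ∀ᶠ j in atTop,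
      (QuantumLattice.expect (hubbardTorusTT' (Ls j) 1 tp U - (μ' : ℂ) • totalNumber) (ψ (Ls j))).re /
          (Ls j : ℝ) ^ 2 =
        (torusAvgExpect (Ls j) (thicken ({0} : Finset (Site 2)) 1)
            ((hubbardTTPrimeFermionInteraction 1 tp U).meanEnergyObs 1) (ψ (Ls j))).re -
          μ' * ((torusAvgExpect (Ls j) ({0} : Finset (Site 2)) (nAt 0 (Finset.mem_singleton_self 0) 0)
              (ψ (Ls j))).re +
            (torusAvgExpect (Ls j) ({0} : Finset (Site 2)) (nAt 0 (Finset.mem_singleton_self 0) 1)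
              (ψ (Ls j))).re) := by
    filter_upwards [hLs.eventually_ge_atTop 3] with j hj
    haveI : NeZero (Ls j) := ⟨by omega⟩
    rw [torusAvgExpect_hubbardTTPrime_meanEnergyObs 1 tp U hj, torusAvgExpect_nAt, torusAvgExpect_nAt]
    have hN : (totalNumber : Matrix (Finset (Orb (FermionTorus 2 (Ls j)))) (Finset (Orb (FermionTorus 2 (Ls j)))) ℂ) =
        (∑ y : FermionTorus 2 (Ls j), numberOp y 0) + ∑ y : FermionTorus 2 (Ls j), numberOp y 1 := by
      rw [totalNumber, ← Finset.sum_add_distrib]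
      exact Finset.sum_congr rfl fun y _ => Fin.sum_univ_two _
    rw [hN]
    have hLc : ((Ls j : ℂ)) ^ 2 = (((Ls j : ℝ) ^ 2 : ℝ) : ℂ) := by push_cast; ring
    simp only [QuantumLattice.expect, Matrix.sub_mulVec, Matrix.add_mulVec, Matrix.smul_mulVec, dotProduct_sub,
      dotProduct_add, dotProduct_smul, smul_eq_mul, hLc, Complex.div_ofReal_re, Complex.sub_re, Complex.add_re,
      Complex.mul_re, Complex.ofReal_re, Complex.ofReal_im, zero_mul, sub_zero]
    have hL0 : ((Ls j : ℝ)) ^ 2 ≠ 0 := by positivity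
    field_simp
  refine Tendsto.congr' (EventuallyEq.symm hseq) ?_
  have hre : ∀ {f : ℕ → ℂ} {a : ℂ}, Tendsto f atTop (𝓝 a) → Tendsto (fun j => (f j).re) atTop (𝓝 a.re) :=
    fun hf => (Complex.continuous_re.tendsto _).comp hf
  exact (hre hE).sub (((hre hN0).add (hre hN1)).const_mul μ')

/-- `G_L(μ') = H_L − μ'N` is Hermitian. [folklore] -/
private theorem isHermitian_hubbardTorusTT'_sub_mul_totalNumber (L : ℕ) [NeZero L] (tp U μ' : ℝ) :
    (hubbardTorusTT' L 1 tp U - (μ' : ℂ) • totalNumber).IsHermitian := by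
  rw [← dWaveSourceTorusTT'_zero_source]
  exact dWaveSourceTorusTT'_isHermitian L tp U μ' 0

/-- **A grand-canonical torus energy FLOOR at `μ'` bounds `e^{tt'}(ω) − μ'ρ(ω)` from below** for every
torus limit of unit vectors: `∀ᶠ j, lo·L_j² ≤ E₀(H_{L_j} − μ'N)` gives
`lo ≤ ω.meanEnergy (hubbardTTPrimeMuInteraction 1 tp U μ') 1`. [cite: Tasaki2020, §2.1] -/
theorem InfVolFermionState.IsTorusLimitOf.le_meanEnergy_hubbardTTPrimeMu_of_groundEnergy_ge
    (hω : ω.IsTorusLimitOf ψ Ls) (hLs : Tendsto Ls atTop atTop) (hψ : ∀ j, star (ψ (Ls j)) ⬝ᵥ ψ (Ls j) = 1)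
    (tp U μ' : ℝ) {lo : ℝ}
    (hlo : ∀ᶠ j in atTop, lo * (Ls j : ℝ) ^ 2 ≤
      Matrix.groundEnergy (hubbardTorusTT' (Ls j) 1 tp U - (μ' : ℂ) • totalNumber)) :
    lo ≤ ω.meanEnergy (hubbardTTPrimeMuInteraction 1 tp U μ') 1 := by
  refine ge_of_tendsto (hω.tendsto_re_expect_hubbardTorusTT'_sub_mul_totalNumber hLs tp U μ') ?_
  filter_upwards [hlo, hLs.eventually_ge_atTop 1] with j hj hj1
  haveI : NeZero (Ls j) := ⟨by omega⟩
  have hL : (0 : ℝ) < (Ls j : ℝ) ^ 2 := by positivity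
  rw [le_div_iff₀ hL]
  exact hj.trans (Matrix.groundEnergy_le_rayleigh_holds
    (isHermitian_hubbardTorusTT'_sub_mul_totalNumber (Ls j) tp U μ') (ψ (Ls j)) (hψ j))

/-- **A grand-canonical CEILING at the chemical potential of the ground states bounds
`e^{tt'}(ω) − μρ(ω)` from above**: unit ground-state vectors of `G_{L_j}(μ)` with
`∀ᶠ j, E₀(G_{L_j}(μ)) ≤ hi·L_j²` give `ω.meanEnergy (hubbardTTPrimeMuInteraction 1 tp U μ) 1 ≤ hi`.
[cite: Tasaki2020, §2.1] -/
theorem InfVolFermionState.IsTorusLimitOf.meanEnergy_hubbardTTPrimeMu_le_of_groundState_of_groundEnergy_le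
    (hω : ω.IsTorusLimitOf ψ Ls) (hLs : Tendsto Ls atTop atTop) (hψ : ∀ j, star (ψ (Ls j)) ⬝ᵥ ψ (Ls j) = 1)
    (tp U μ : ℝ)
    (hgs : ∀ j, (hubbardTorusTT' (Ls j) 1 tp U - (μ : ℂ) • totalNumber) *ᵥ ψ (Ls j) =
      ((Matrix.groundEnergy (hubbardTorusTT' (Ls j) 1 tp U - (μ : ℂ) • totalNumber) : ℝ) : ℂ) • ψ (Ls j))
    {hi : ℝ}
    (hhi : ∀ᶠ j in atTop, Matrix.groundEnergy (hubbardTorusTT' (Ls j) 1 tp U - (μ : ℂ) • totalNumber) ≤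
      hi * (Ls j : ℝ) ^ 2) :
    ω.meanEnergy (hubbardTTPrimeMuInteraction 1 tp U μ) 1 ≤ hi := by
  refine le_of_tendsto (hω.tendsto_re_expect_hubbardTorusTT'_sub_mul_totalNumber hLs tp U μ) ?_
  filter_upwards [hhi, hLs.eventually_ge_atTop 1] with j hj hj1
  have hL : (0 : ℝ) < (Ls j : ℝ) ^ 2 := by positivity
  rw [div_le_iff₀ hL]
  have hval : (QuantumLattice.expect (hubbardTorusTT' (Ls j) 1 tp U - (μ : ℂ) • totalNumber) (ψ (Ls j))).re =
      Matrix.groundEnergy (hubbardTorusTT' (Ls j) 1 tp U - (μ : ℂ) • totalNumber) := by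
    rw [QuantumLattice.expect, hgs j, dotProduct_smul, hψ j, smul_eq_mul, mul_one, Complex.ofReal_re]
  rw [hval]
  exact hj

/-- **The density of a thermodynamic-limit grand-canonical ground state, bracketed by three certified torus
energy rows** (Ruelle's `ρ ∈ −∂e_GC(μ)` read from finite tori): for a torus limit `ω` of unit
ground-state vectors of `G_L(μ) = H_L(1,tp,U) − μN` and rows `lo₋·L² ≤ E₀(G_L(μ − δ))`,
`lo₊·L² ≤ E₀(G_L(μ + δ))`, `E₀(G_L(μ)) ≤ hi·L²` valid for all large `L = L_j` (`δ > 0`),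
`(lo₋ − hi)/δ ≤ ρ(ω) ≤ (hi − lo₊)/δ`. [cite: Ruelle1969, §3.4] -/
theorem InfVolFermionState.IsTorusLimitOf.density_mem_Icc_of_groundEnergy_rows
    (hω : ω.IsTorusLimitOf ψ Ls) (hLs : Tendsto Ls atTop atTop) (hψ : ∀ j, star (ψ (Ls j)) ⬝ᵥ ψ (Ls j) = 1)
    (tp U μ : ℝ)
    (hgs : ∀ j, (hubbardTorusTT' (Ls j) 1 tp U - (μ : ℂ) • totalNumber) *ᵥ ψ (Ls j) =
      ((Matrix.groundEnergy (hubbardTorusTT' (Ls j) 1 tp U - (μ : ℂ) • totalNumber) : ℝ) : ℂ) • ψ (Ls j))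
    {δ loMinus loPlus hi : ℝ} (hδ : 0 < δ)
    (hloMinus : ∀ᶠ j in atTop, loMinus * (Ls j : ℝ) ^ 2 ≤
      Matrix.groundEnergy (hubbardTorusTT' (Ls j) 1 tp U - ((μ - δ : ℝ) : ℂ) • totalNumber))
    (hloPlus : ∀ᶠ j in atTop, loPlus * (Ls j : ℝ) ^ 2 ≤
      Matrix.groundEnergy (hubbardTorusTT' (Ls j) 1 tp U - ((μ + δ : ℝ) : ℂ) • totalNumber))
    (hhi : ∀ᶠ j in atTop, Matrix.groundEnergy (hubbardTorusTT' (Ls j) 1 tp U - (μ : ℂ) • totalNumber) ≤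
      hi * (Ls j : ℝ) ^ 2) :
    ω.density ∈ Set.Icc ((loMinus - hi) / δ) ((hi - loPlus) / δ) := by
  have h1 := hω.le_meanEnergy_hubbardTTPrimeMu_of_groundEnergy_ge hLs hψ tp U (μ - δ) hloMinus
  have h2 := hω.le_meanEnergy_hubbardTTPrimeMu_of_groundEnergy_ge hLs hψ tp U (μ + δ) hloPlus
  have h3 := hω.meanEnergy_hubbardTTPrimeMu_le_of_groundState_of_groundEnergy_le hLs hψ tp U μ hgs hhi
  rw [InfVolFermionState.meanEnergy_hubbardTTPrimeMu] at h1 h2 h3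
  constructor
  · rw [div_le_iff₀ hδ]
    linarith
  · rw [le_div_iff₀ hδ]
    linarith

/-- Dually, **the grand-canonical energy density of the limit is pinned**: floor and ceiling rows at the
same `μ` give `lo ≤ e^{tt'}(ω) − μρ(ω) ≤ hi`, whence with `tiGroundEnergyDensity_le_meanEnergy` the
certified cap `e_GC(μ) := tiGroundEnergyDensity (hubbardTTPrimeMuInteraction 1 tp U μ) 1 ≤ hi`.
[cite: Ruelle1969, §3.4] -/
theorem InfVolFermionState.IsTorusLimitOf.tiGroundEnergyDensity_hubbardTTPrimeMu_le_of_groundState_of_groundEnergy_le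
    (hω : ω.IsTorusLimitOf ψ Ls) (hLs : Tendsto Ls atTop atTop) (hψ : ∀ j, star (ψ (Ls j)) ⬝ᵥ ψ (Ls j) = 1)
    (tp U μ : ℝ)
    (hgs : ∀ j, (hubbardTorusTT' (Ls j) 1 tp U - (μ : ℂ) • totalNumber) *ᵥ ψ (Ls j) =
      ((Matrix.groundEnergy (hubbardTorusTT' (Ls j) 1 tp U - (μ : ℂ) • totalNumber) : ℝ) : ℂ) • ψ (Ls j))
    {hi : ℝ}
    (hhi : ∀ᶠ j in atTop, Matrix.groundEnergy (hubbardTorusTT' (Ls j) 1 tp U - (μ : ℂ) • totalNumber) ≤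
      hi * (Ls j : ℝ) ^ 2) :
    (hubbardTTPrimeMuInteraction 1 tp U μ).tiGroundEnergyDensity 1 ≤ hi :=
  ((hubbardTTPrimeMuInteraction 1 tp U μ).tiGroundEnergyDensity_le_meanEnergy 1 hω.isTranslationInvariant).trans
    (hω.meanEnergy_hubbardTTPrimeMu_le_of_groundState_of_groundEnergy_le hLs hψ tp U μ hgs hhi)

/-- **Non-vacuity for the `μ`-pencil**: along (a subsequence of) every `Ls → ∞` there are unit ground-state
vectors of `G_L(μ) = H_L(1,tp,U) − μN` with a translation-invariant torus-limit state; hence three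
grand-canonical rows valid eventually along `Ls` PRODUCE a translation-invariant state `ω` with
`(lo₋ − hi)/δ ≤ ρ(ω) ≤ (hi − lo₊)/δ` and `e^{tt'}(ω) − μρ(ω) ≤ hi`. [cite: Ruelle1969, §3.4] -/
theorem exists_isTranslationInvariant_density_mem_Icc_of_groundEnergy_rows_along (tp U μ : ℝ) {Ls : ℕ → ℕ}
    [hL0 : ∀ j, NeZero (Ls j)] (hLs : Tendsto Ls atTop atTop) {δ loMinus loPlus hi : ℝ} (hδ : 0 < δ)
    (hloMinus : ∀ᶠ j in atTop, loMinus * (Ls j : ℝ) ^ 2 ≤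
      Matrix.groundEnergy (hubbardTorusTT' (Ls j) 1 tp U - ((μ - δ : ℝ) : ℂ) • totalNumber))
    (hloPlus : ∀ᶠ j in atTop, loPlus * (Ls j : ℝ) ^ 2 ≤
      Matrix.groundEnergy (hubbardTorusTT' (Ls j) 1 tp U - ((μ + δ : ℝ) : ℂ) • totalNumber))
    (hhi : ∀ᶠ j in atTop, Matrix.groundEnergy (hubbardTorusTT' (Ls j) 1 tp U - (μ : ℂ) • totalNumber) ≤
      hi * (Ls j : ℝ) ^ 2) :
    ∃ ω : InfVolFermionState 2, ω.IsTranslationInvariant ∧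
      (∃ (ψ : ∀ L, Fock (Orb (FermionTorus 2 L))) (φ : ℕ → ℕ), StrictMono φ ∧
        (∀ j, star (ψ (Ls j)) ⬝ᵥ ψ (Ls j) = 1) ∧
        (∀ j, (hubbardTorusTT' (Ls j) 1 tp U - (μ : ℂ) • totalNumber) *ᵥ ψ (Ls j) =
          ((Matrix.groundEnergy (hubbardTorusTT' (Ls j) 1 tp U - (μ : ℂ) • totalNumber) : ℝ) : ℂ) • ψ (Ls j)) ∧
        ω.IsTorusLimitOf ψ (Ls ∘ φ)) ∧
      ω.density ∈ Set.Icc ((loMinus - hi) / δ) ((hi - loPlus) / δ) ∧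
      ω.meanEnergy (hubbardTTPrimeMuInteraction 1 tp U μ) 1 ≤ hi := by
  obtain ⟨ψ, φ, ω, hφ, hgs, hψ1, hω, hTI⟩ := exists_isTorusLimitOf_dWaveSourceGroundStates tp U μ 0 hLs
  have hgs' : ∀ j, (hubbardTorusTT' (Ls j) 1 tp U - (μ : ℂ) • totalNumber) *ᵥ ψ (Ls j) =
      ((Matrix.groundEnergy (hubbardTorusTT' (Ls j) 1 tp U - (μ : ℂ) • totalNumber) : ℝ) : ℂ) • ψ (Ls j) := by
    intro j
    rw [← dWaveSourceTorusTT'_zero_source]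
    exact hgs j
  have hLφ : Tendsto (fun j => Ls (φ j)) atTop atTop := hLs.comp hφ.tendsto_atTop
  have hω' : ω.IsTorusLimitOf ψ (fun j => Ls (φ j)) := hω
  refine ⟨ω, hTI, ⟨ψ, φ, hφ, hψ1, hgs', hω⟩, ?_, ?_⟩
  · exact hω'.density_mem_Icc_of_groundEnergy_rows hLφ (fun j => hψ1 (φ j)) tp U μ (fun j => hgs' (φ j)) hδ
      (hφ.tendsto_atTop.eventually hloMinus) (hφ.tendsto_atTop.eventually hloPlus)
      (hφ.tendsto_atTop.eventually hhi)
  · exact hω'.meanEnergy_hubbardTTPrimeMu_le_of_groundState_of_groundEnergy_le hLφ (fun j => hψ1 (φ j)) tp U μ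
      (fun j => hgs' (φ j)) (hφ.tendsto_atTop.eventually hhi)

end ChemicalPotential

end Literature.MathematicalPhysics.QuantumLattice

end
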